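import Literature.Analysis.FluidPDE.Seregin2023.PowerWeightEulerZoom
import Literature.Analysis.FluidPDE.SuitableWeakInBallTools
import Literature.Analysis.FluidPDE.LocalTypeIScaling
import Literature.Analysis.FluidPDE.CKNScalingExtras
import HarnessLib

/-!
# Seregin 2026, Thm 3.1 at the power weight: the Navier–Stokes zoom of a power-gauged Type II
# scenario in `Q(z₀, r₀)` to the unit cylinder `Q(0, 1)` (all proved)

Analysis/FluidPDE proof file (no definitions, no named facts, no `sorry`), sequel of
`PowerWeightEulerZoom.lean`. Seregin's Theorem 3.1 (G. Seregin, *On potential Type II blowups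
for the Navier–Stokes equations*, arXiv:2606.29468; tree fact
`seregin2026_typeII_scenario_eulerLimit`) is printed for a suitable weak solution in the UNIT
parabolic cylinder `Q = Q(0,1)` ("by scaling", §1 p. 2). The §B route `EulerZoomLiouville` of the
summit NavierStokesRegularity states its support item `SereginZoomReduction`
(stmt-NavierStokesRegularity-19834) for an arbitrary cylinder `Q(z₀, r₀)`. This file performs the
Navier–Stokes zoom `Φ(s, y) = (t₀ + r₀² s, x₀ + r₀ y)`, `V = r₀ v ∘ Φ`, `P = r₀² q ∘ Φ`,
`H = r₀² G ∘ Φ` (accepted covariances `IsSuitableWeakSolutionInBall.zoom`,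
`HasWeakSpatialGradientOn.stRescale`, `cknAEss_nsZoom`, `cknE_nsZoom`, `cknD_nsZoom`,
`setLIntegral_enorm_pow_stRescale`) on the two scenario hypotheses of the route decl:

* `hasWeightedEnergyBound_zoom` — the power-gauged bound
  `r^{2ρ} A(r; z₀) + r^{ρ} E(r; z₀) + r^{2ρ} D(r; z₀) ≤ M` on `]0, r₀]` gives Seregin's (1.7)
  `A_f + E_f + D_f ≤ M₁` on `]0,1[` for `(V, P, H)` with `f(r) = r^ρ` and
  `M₁ = (2 r₀^{-2ρ} + r₀^{-ρ}) M` (the weight is NOT scale invariant: `f(r₀ r) = r₀^ρ f(r)`, whence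
  the constant; `weightedA_rpow_eq` records `A_f = r^{2ρ} A_{ess}`);
* `floor_zoom` — the floor (3.1) in the route's form,
  `∀ δ > 0, ∃ r ∈ ]0,δ[, ε₀ ≤ r^{2ρ-2} ∫_{]t₀ - r^{2+ρ}, t₀[ × B(x₀, r)} |v|³`, gives the same for
  `V` at the origin with `ε₁ = (c/r₀)^{2ρ-2} r₀^{-2} ε₀`, `c = max(1, r₀^{ρ/(2+ρ)})`. The window
  length `r^{2+ρ}` is NOT Navier–Stokes covariant (`Φ⁻¹` of the window of radius `r₀ r` is
  `]-r₀^{ρ} r^{2+ρ}, 0[ × B(0, r)`); it is absorbed by passing to the larger radius `c r`, whose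
  window contains the zoomed one (monotonicity of the integral);
* `exists_unitCylinder_scenario` — the package: from the route's data at `(z₀, r₀)` the complete
  hypothesis list of `seregin2026_typeII_scenario_eulerLimit` at `(s, l, κ, η) = (3, 3, 2, 0)`,
  `f = r^ρ`, for `(V, P, H)` (suitability in `Q(0,1)`, weak gradient, `(1.7)`, and the floor along a
  strictly decreasing null sequence `r_k ∈ ]0,1[`, via `rpow_mul_morreyMbar_rpow_eq`);
* `seregin2026_typeII_scenario_eulerLimit.of_powerGauge_ball` — composition with the fact: under
  `seregin2026_typeII_scenario_eulerLimit`, the route's scenario at `(z₀, r₀)` with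
  `0 < ρ ≤ 17/20` yields Seregin's non-trivial Euler limit `(u, p, Gu, c)` with `F(a) = a^ρ`
  (conclusion of Thm 3.1 verbatim). What then remains of item 19834 is the passage from this
  conclusion to the route's `IsSuitableWeakSolutionOn (slab ]-∞,0[) 0 0 u p` with the `sup`-form
  gauge `cknA` (piece (e) of `PowerWeightEulerZoom.lean`'s docstring; Summits-side).

[cite: Seregin2026, §1 p. 2 ("by scaling … in the unit parabolic cylinder"), (1.7) p. 4, (3.1) p. 8,
Thm 3.1 p. 9]; the scaling bookkeeping is Caffarelli–Kohn–Nirenberg 1982, §2.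
-/

noncomputable section

open MeasureTheory Set Filter Topology Metric Function Module
open scoped ENNReal NNReal

namespace Literature.Analysis.FluidPDE.Seregin2023

/-! ### Bookkeeping for the zoom `Φ(s, y) = (t₀ + r₀² s, x₀ + r₀ y)` -/

/-- `Φ(0) = z₀`. [folklore] -/
private theorem stAffine_sq_zero (r₀ : ℝ) (z₀ : ℝ × EuclideanSpace ℝ (Fin 3)) :
    stAffine (r₀ ^ 2) r₀ z₀.1 z₀.2 (0 : ℝ × EuclideanSpace ℝ (Fin 3)) = z₀ :=
  Prod.ext (by simp [stAffine]) (by simp [stAffine])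

/-- **The zoom carries the weak gradient**: `H = r₀² G ∘ Φ` is a weak spatial gradient of
`V = r₀ v ∘ Φ` on `Q(0,1) = Φ⁻¹(Q(z₀, r₀))`. [cite: CaffarelliKohnNirenberg1982, §2 (scaling of (2.1))] -/
theorem hasWeakSpatialGradientOn_zoom {r₀ : ℝ} (hr₀ : 0 < r₀) (z₀ : ℝ × EuclideanSpace ℝ (Fin 3))
    {v : ℝ → EuclideanSpace ℝ (Fin 3) → EuclideanSpace ℝ (Fin 3)}
    {G : ℝ → EuclideanSpace ℝ (Fin 3) → EuclideanSpace ℝ (Fin 3) →L[ℝ] EuclideanSpace ℝ (Fin 3)}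
    (hG : HasWeakSpatialGradientOn (parabolicCylinderOpens r₀ z₀) v G) :
    HasWeakSpatialGradientOn (parabolicCylinderOpens 1 (0 : ℝ × EuclideanSpace ℝ (Fin 3)))
      (r₀ • stPull (r₀ ^ 2) r₀ z₀.1 z₀.2 v) (r₀ ^ 2 • stPull (r₀ ^ 2) r₀ z₀.1 z₀.2 G) := by
  have h := hG.stRescale r₀ (pow_pos hr₀ 2) hr₀ z₀.1 z₀.2
  rw [zoom_stPreimage_parabolicCylinderOpens hr₀ z₀, ← pow_two] at h
  exact h

/-! ### (1.7): the power-gauged bound under the zoom -/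

/-- `A_f(v, r) = r^{2ρ} A_{ess}(v; Q(z, r))` for `f(r) = r^ρ`, `r > 0` (`(r^ρ)²/r = r^{2ρ} r⁻¹`,
constants leave the essential supremum). [cite: Seregin2026, (1.7) (p. 4)] -/
theorem weightedA_rpow_eq {ρ r : ℝ} (hr : 0 < r) (z : ℝ × EuclideanSpace ℝ (Fin 3))
    (v : ℝ → EuclideanSpace ℝ (Fin 3) → EuclideanSpace ℝ (Fin 3)) :
    weightedA (fun s => s ^ ρ) r z v = ENNReal.ofReal (r ^ (2 * ρ)) * cknAEss r z v := by
  unfold weightedA cknAEss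
  rw [ENNReal.essSup_const_mul, ENNReal.essSup_const_mul, ← mul_assoc]
  congr 1
  rw [div_eq_mul_inv, ENNReal.ofReal_mul (by positivity), ENNReal.ofReal_inv_of_pos hr,
    ← Real.rpow_natCast (r ^ ρ) 2, ← Real.rpow_mul hr.le, mul_comm ρ]
  norm_num

/-- `E_f(G, r) = r^{ρ} E(r)` for `f(r) = r^ρ`, `r > 0`. [cite: Seregin2026, (1.7) (p. 4)] -/
theorem weightedE_rpow_eq {ρ r : ℝ} (hr : 0 < r) (z : ℝ × EuclideanSpace ℝ (Fin 3))
    (G : ℝ → EuclideanSpace ℝ (Fin 3) → EuclideanSpace ℝ (Fin 3) →L[ℝ] EuclideanSpace ℝ (Fin 3)) :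
    weightedE (fun s => s ^ ρ) r z G = ENNReal.ofReal (r ^ ρ) * cknE r z G := by
  unfold weightedE cknE
  rw [← mul_assoc, div_eq_mul_inv, ENNReal.ofReal_mul (by positivity),
    ENNReal.ofReal_inv_of_pos hr]

/-- `D_f(q, r) = r^{2ρ} D(r)` for `f(r) = r^ρ`, `r > 0`. [cite: Seregin2026, (1.7) (p. 4)] -/
theorem weightedD_rpow_eq {ρ r : ℝ} (hr : 0 < r) (z : ℝ × EuclideanSpace ℝ (Fin 3))
    (q : ℝ → EuclideanSpace ℝ (Fin 3) → ℝ) :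
    weightedD (fun s => s ^ ρ) r z q = ENNReal.ofReal (r ^ (2 * ρ)) * cknD r z q := by
  unfold weightedD cknD
  rw [← mul_assoc, div_eq_mul_inv, ENNReal.ofReal_mul (by positivity), ← ENNReal.ofReal_pow hr.le,
    ENNReal.ofReal_inv_of_pos (by positivity), ← Real.rpow_natCast (r ^ ρ) 2,
    ← Real.rpow_mul hr.le, mul_comm ρ]
  norm_num

/-- `r^θ = r₀^{-θ} (r₀ r)^θ` inside `ofReal`, for `r₀ > 0`, `r ≥ 0`. [folklore] -/
private theorem ofReal_rpow_eq_mul {r₀ r θ : ℝ} (hr₀ : 0 < r₀) (hr : 0 ≤ r) :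
    ENNReal.ofReal (r ^ θ) = ENNReal.ofReal (r₀ ^ (-θ)) * ENNReal.ofReal ((r₀ * r) ^ θ) := by
  rw [← ENNReal.ofReal_mul (by positivity), Real.mul_rpow hr₀.le hr, ← mul_assoc,
    Real.rpow_neg hr₀.le, inv_mul_cancel₀ (Real.rpow_pos_of_pos hr₀ θ).ne', one_mul]

/-- **(1.7) under the zoom.** If `r^{2ρ} A(r; z₀) + r^{ρ} E(r; z₀) + r^{2ρ} D(r; z₀) ≤ M` for all
`r ∈ ]0, r₀]` (CKN quantities of `(v, q)` with weak gradient `G`, `A` a genuine supremum), then the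
zoomed triple `(V, P, H) = (r₀ v ∘ Φ, r₀² q ∘ Φ, r₀² G ∘ Φ)` satisfies Seregin's (1.7) at the origin
with `f(r) = r^ρ` and the constant `(r₀^{-2ρ} + r₀^{-ρ} + r₀^{-2ρ}) M`
(`A_f(V, r) = r^{2ρ} A_{ess}(V; r) = r^{2ρ} A_{ess}(v; Q(z₀, r₀ r)) ≤ r₀^{-2ρ} (r₀ r)^{2ρ} A(v; r₀ r)`,
and similarly for `E`, `D`). [cite: Seregin2026, (1.7) (p. 4) with §1 p. 2 ("by scaling")] -/
theorem hasWeightedEnergyBound_zoom {ρ r₀ : ℝ} (hr₀ : 0 < r₀) (z₀ : ℝ × EuclideanSpace ℝ (Fin 3))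
    {M : ℝ≥0} {v : ℝ → EuclideanSpace ℝ (Fin 3) → EuclideanSpace ℝ (Fin 3)}
    {q : ℝ → EuclideanSpace ℝ (Fin 3) → ℝ}
    {G : ℝ → EuclideanSpace ℝ (Fin 3) → EuclideanSpace ℝ (Fin 3) →L[ℝ] EuclideanSpace ℝ (Fin 3)}
    (hM : ∀ r ∈ Ioc (0 : ℝ) r₀,
      ENNReal.ofReal (r ^ (2 * ρ)) * cknA r z₀ v + ENNReal.ofReal (r ^ ρ) * cknE r z₀ G +
          ENNReal.ofReal (r ^ (2 * ρ)) * cknD r z₀ q ≤ (M : ℝ≥0∞)) :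
    HasWeightedEnergyBound (fun s => s ^ ρ)
      ((r₀ ^ (-(2 * ρ)) + r₀ ^ (-ρ) + r₀ ^ (-(2 * ρ))).toNNReal * M)
      (r₀ • stPull (r₀ ^ 2) r₀ z₀.1 z₀.2 v) (r₀ ^ 2 • stPull (r₀ ^ 2) r₀ z₀.1 z₀.2 q)
      (r₀ ^ 2 • stPull (r₀ ^ 2) r₀ z₀.1 z₀.2 G) := by
  intro r hr
  have hr0 : 0 < r := hr.1
  have hrr : r₀ * r ∈ Ioc (0 : ℝ) r₀ := ⟨mul_pos hr₀ hr0, by nlinarith [hr.2]⟩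
  have hMr := hM (r₀ * r) hrr
  have hz := stAffine_sq_zero r₀ z₀
  -- the three terms
  have hA : weightedA (fun s => s ^ ρ) r (0 : ℝ × EuclideanSpace ℝ (Fin 3))
      (r₀ • stPull (r₀ ^ 2) r₀ z₀.1 z₀.2 v) ≤ ENNReal.ofReal (r₀ ^ (-(2 * ρ))) * M := by
    rw [weightedA_rpow_eq hr0, cknAEss_nsZoom hr₀ hr0, hz, ofReal_rpow_eq_mul hr₀ hr0.le,
      mul_assoc]
    gcongr
    calc ENNReal.ofReal ((r₀ * r) ^ (2 * ρ)) * cknAEss (r₀ * r) z₀ v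
        ≤ ENNReal.ofReal ((r₀ * r) ^ (2 * ρ)) * cknA (r₀ * r) z₀ v := by
          gcongr; exact cknAEss_le_cknA
      _ ≤ _ := le_trans (le_add_right (le_add_right le_rfl)) hMr
  have hE : weightedE (fun s => s ^ ρ) r (0 : ℝ × EuclideanSpace ℝ (Fin 3))
      (r₀ ^ 2 • stPull (r₀ ^ 2) r₀ z₀.1 z₀.2 G) ≤ ENNReal.ofReal (r₀ ^ (-ρ)) * M := by
    rw [weightedE_rpow_eq hr0, cknE_nsZoom hr₀ hr0, hz, ofReal_rpow_eq_mul hr₀ hr0.le, mul_assoc]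
    gcongr
    exact le_trans (le_add_right (le_add_left le_rfl)) hMr
  have hD : weightedD (fun s => s ^ ρ) r (0 : ℝ × EuclideanSpace ℝ (Fin 3))
      (r₀ ^ 2 • stPull (r₀ ^ 2) r₀ z₀.1 z₀.2 q) ≤ ENNReal.ofReal (r₀ ^ (-(2 * ρ))) * M := by
    rw [weightedD_rpow_eq hr0, cknD_nsZoom hr₀ hr0, hz, ofReal_rpow_eq_mul hr₀ hr0.le, mul_assoc]
    gcongr
    exact le_trans (le_add_left le_rfl) hMr
  have hcoe : (((r₀ ^ (-(2 * ρ)) + r₀ ^ (-ρ) + r₀ ^ (-(2 * ρ))).toNNReal * M : ℝ≥0) : ℝ≥0∞) =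
      (ENNReal.ofReal (r₀ ^ (-(2 * ρ))) + ENNReal.ofReal (r₀ ^ (-ρ)) +
        ENNReal.ofReal (r₀ ^ (-(2 * ρ)))) * M := by
    rw [ENNReal.coe_mul, ← ENNReal.ofReal_add (by positivity) (by positivity),
      ← ENNReal.ofReal_add (by positivity) (by positivity)]
    rfl
  rw [hcoe, add_mul, add_mul]
  exact add_le_add (add_le_add hA hE) hD

/-! ### (3.1): the floor under the zoom -/

/-- `Φ⁻¹(]t₀ - τ, t₀[ × B(x₀, R)) = ]-τ/r₀², 0[ × B(0, R/r₀)`. [folklore] -/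
private theorem stAffine_sq_preimage_window {r₀ : ℝ} (hr₀ : 0 < r₀)
    (z₀ : ℝ × EuclideanSpace ℝ (Fin 3)) (τ R : ℝ) :
    stAffine (r₀ ^ 2) r₀ z₀.1 z₀.2 ⁻¹' (Ioo (z₀.1 - τ) z₀.1 ×ˢ ball z₀.2 R) =
      Ioo (-τ / r₀ ^ 2) 0 ×ˢ ball (0 : EuclideanSpace ℝ (Fin 3)) (R / r₀) := by
  rw [stAffine_preimage_cylinder (pow_pos hr₀ 2) hr₀]
  congr 2
  · ring
  · simp
  · simp

/-- The cubic functional under the zoom: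
`∫_{Φ⁻¹ S} |V|³ = r₀^{-2} ∫_S |v|³` (`r₀³ · (r₀² r₀³)⁻¹`). [cite: CaffarelliKohnNirenberg1982, §2 (scaling of C)] -/
private theorem setLIntegral_cube_zoom {r₀ : ℝ} (hr₀ : 0 < r₀) (z₀ : ℝ × EuclideanSpace ℝ (Fin 3))
    (v : ℝ → EuclideanSpace ℝ (Fin 3) → EuclideanSpace ℝ (Fin 3))
    (S : Set (ℝ × EuclideanSpace ℝ (Fin 3))) :
    ∫⁻ w in stAffine (r₀ ^ 2) r₀ z₀.1 z₀.2 ⁻¹' S,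
        ‖(r₀ • stPull (r₀ ^ 2) r₀ z₀.1 z₀.2 v) w.1 w.2‖ₑ ^ (3 : ℕ) =
      ENNReal.ofReal ((r₀ ^ 2)⁻¹) * ∫⁻ w in S, ‖v w.1 w.2‖ₑ ^ (3 : ℕ) := by
  rw [setLIntegral_enorm_pow_stRescale (pow_pos hr₀ 2) hr₀ z₀.1 z₀.2 r₀ v S 3,
    ofReal_sq_mul_cube_inv r₀, Real.enorm_eq_ofReal hr₀.le, ← ENNReal.ofReal_pow hr₀.le,
    ← ENNReal.ofReal_mul (by positivity)]
  congr 2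
  field_simp

/-- **The floor (3.1) under the zoom.** If for every `δ > 0` some `r ∈ ]0, δ[` has
`ε₀ ≤ r^{2ρ-2} ∫_{]t₀ - r^{2+ρ}, t₀[ × B(x₀, r)} |v|³` (`ε₀ > 0`, `ρ > 0`), then the zoomed field
`V = r₀ v ∘ Φ` has the same property at the origin with the constant
`ε₁ = (c/r₀)^{2ρ-2} (r₀²)⁻¹ ε₀ > 0`, `c = max(1, r₀^{ρ/(2+ρ)})`: the window of `v` of radius `r'`
pulls back under `Φ` to `]-r'^{2+ρ}/r₀², 0[ × B(0, r'/r₀)`, which lies inside the origin-centred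
window of radius `s = c r'/r₀` (`c ≥ 1` and `c^{2+ρ} ≥ r₀^{ρ}`), and `∫_{Φ⁻¹ W} |V|³ = r₀^{-2} ∫_W |v|³`.
[cite: Seregin2026, (3.1) (p. 8) with §1 p. 2 ("by scaling")] -/
theorem floor_zoom {ρ r₀ ε₀ : ℝ} (hρ : 0 < ρ) (hr₀ : 0 < r₀) (hε₀ : 0 < ε₀)
    (z₀ : ℝ × EuclideanSpace ℝ (Fin 3))
    (v : ℝ → EuclideanSpace ℝ (Fin 3) → EuclideanSpace ℝ (Fin 3))
    (hfloor : ∀ δ : ℝ, 0 < δ → ∃ r ∈ Ioo (0 : ℝ) δ,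
      ENNReal.ofReal ε₀ ≤ ENNReal.ofReal (r ^ (2 * ρ - 2)) *
        ∫⁻ w in Ioo (z₀.1 - r ^ (2 + ρ)) z₀.1 ×ˢ ball z₀.2 r, ‖v w.1 w.2‖ₑ ^ (3 : ℕ)) :
    ∃ ε₁ : ℝ, 0 < ε₁ ∧ ∀ δ : ℝ, 0 < δ → ∃ s ∈ Ioo (0 : ℝ) δ,
      ENNReal.ofReal ε₁ ≤ ENNReal.ofReal (s ^ (2 * ρ - 2)) *
        ∫⁻ w in Ioo ((0 : ℝ × EuclideanSpace ℝ (Fin 3)).1 - s ^ (2 + ρ))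
            (0 : ℝ × EuclideanSpace ℝ (Fin 3)).1 ×ˢ
          ball (0 : ℝ × EuclideanSpace ℝ (Fin 3)).2 s,
          ‖(r₀ • stPull (r₀ ^ 2) r₀ z₀.1 z₀.2 v) w.1 w.2‖ₑ ^ (3 : ℕ) := by
  set c : ℝ := max 1 (r₀ ^ (ρ / (2 + ρ))) with hc
  have hc1 : 1 ≤ c := le_max_left _ _
  have hc0 : 0 < c := one_pos.trans_le hc1
  have hcpow : r₀ ^ ρ ≤ c ^ (2 + ρ) := by
    have h1 : r₀ ^ (ρ / (2 + ρ)) ≤ c := le_max_right _ _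
    have h2 : (r₀ ^ (ρ / (2 + ρ))) ^ (2 + ρ) = r₀ ^ ρ := by
      rw [← Real.rpow_mul hr₀.le, div_mul_cancel₀ _ (by positivity)]
    rw [← h2]
    exact Real.rpow_le_rpow (by positivity) h1 (by positivity)
  refine ⟨(c / r₀) ^ (2 * ρ - 2) * (r₀ ^ 2)⁻¹ * ε₀, by positivity, fun δ hδ => ?_⟩
  obtain ⟨r', hr', hε⟩ := hfloor (δ * r₀ / c) (by positivity)
  have hr'0 : 0 < r' := hr'.1
  -- the new radius `s = c r'/r₀`
  set s : ℝ := c * (r' / r₀) with hs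
  have hs0 : 0 < s := by positivity
  have hsδ : s < δ := by
    have h2 : r' / r₀ < (δ * r₀ / c) / r₀ := div_lt_div_of_pos_right hr'.2 hr₀
    have h3 : c * ((δ * r₀ / c) / r₀) = δ := by field_simp
    have h4 := mul_lt_mul_of_pos_left h2 hc0
    rw [h3] at h4
    exact h4
  refine ⟨s, ⟨hs0, hsδ⟩, ?_⟩
  -- the zoomed window of radius `r'` sits inside the origin window of radius `s`
  have hρ0 : r₀ ^ ρ ≠ 0 := (Real.rpow_pos_of_pos hr₀ ρ).ne'
  have hsub : Ioo (-(r' ^ (2 + ρ)) / r₀ ^ 2) 0 ×ˢ ball (0 : EuclideanSpace ℝ (Fin 3)) (r' / r₀) ⊆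
      Ioo ((0 : ℝ × EuclideanSpace ℝ (Fin 3)).1 - s ^ (2 + ρ))
          (0 : ℝ × EuclideanSpace ℝ (Fin 3)).1 ×ˢ
        ball (0 : ℝ × EuclideanSpace ℝ (Fin 3)).2 s := by
    have hs_pow : s ^ (2 + ρ) = c ^ (2 + ρ) * (r' ^ (2 + ρ) / r₀ ^ (2 + ρ)) := by
      rw [hs, Real.mul_rpow hc0.le (by positivity), Real.div_rpow hr'0.le hr₀.le]
    have hr₀pow : r₀ ^ (2 + ρ) = r₀ ^ 2 * r₀ ^ ρ := by
      rw [Real.rpow_add hr₀, Real.rpow_two]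
    have key : r' ^ (2 + ρ) / r₀ ^ 2 ≤ s ^ (2 + ρ) := by
      rw [hs_pow, hr₀pow]
      have e : r' ^ (2 + ρ) / r₀ ^ 2 = r₀ ^ ρ * (r' ^ (2 + ρ) / (r₀ ^ 2 * r₀ ^ ρ)) := by
        field_simp
      rw [e]
      gcongr
    have htime : (0 : ℝ × EuclideanSpace ℝ (Fin 3)).1 - s ^ (2 + ρ) ≤ -(r' ^ (2 + ρ)) / r₀ ^ 2 := by
      rw [Prod.fst_zero, zero_sub, neg_div]
      exact neg_le_neg key
    have hball : r' / r₀ ≤ s := by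
      rw [hs]
      exact le_mul_of_one_le_left (by positivity) hc1
    refine prod_mono (Ioo_subset_Ioo htime le_rfl) ?_
    rw [Prod.snd_zero]
    exact ball_subset_ball hball
  -- change of variables on the zoomed window
  have hcov : ∫⁻ w in Ioo (-(r' ^ (2 + ρ)) / r₀ ^ 2) 0 ×ˢ ball (0 : EuclideanSpace ℝ (Fin 3)) (r' / r₀),
      ‖(r₀ • stPull (r₀ ^ 2) r₀ z₀.1 z₀.2 v) w.1 w.2‖ₑ ^ (3 : ℕ) =
      ENNReal.ofReal ((r₀ ^ 2)⁻¹) *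
        ∫⁻ w in Ioo (z₀.1 - r' ^ (2 + ρ)) z₀.1 ×ˢ ball z₀.2 r', ‖v w.1 w.2‖ₑ ^ (3 : ℕ) := by
    rw [← stAffine_sq_preimage_window hr₀ z₀ (r' ^ (2 + ρ)) r', setLIntegral_cube_zoom hr₀ z₀ v]
  -- the constant: `s^{2ρ-2} = (c/r₀)^{2ρ-2} r'^{2ρ-2}`
  have hsr : s ^ (2 * ρ - 2) = (c / r₀) ^ (2 * ρ - 2) * r' ^ (2 * ρ - 2) := by
    rw [show s = (c / r₀) * r' by rw [hs]; ring, Real.mul_rpow (by positivity) hr'0.le]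
  calc ENNReal.ofReal ((c / r₀) ^ (2 * ρ - 2) * (r₀ ^ 2)⁻¹ * ε₀)
      = ENNReal.ofReal ((c / r₀) ^ (2 * ρ - 2) * (r₀ ^ 2)⁻¹) * ENNReal.ofReal ε₀ := by
        rw [ENNReal.ofReal_mul (by positivity)]
    _ ≤ ENNReal.ofReal ((c / r₀) ^ (2 * ρ - 2) * (r₀ ^ 2)⁻¹) *
          (ENNReal.ofReal (r' ^ (2 * ρ - 2)) *
            ∫⁻ w in Ioo (z₀.1 - r' ^ (2 + ρ)) z₀.1 ×ˢ ball z₀.2 r', ‖v w.1 w.2‖ₑ ^ (3 : ℕ)) := by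
        gcongr
    _ = ENNReal.ofReal (s ^ (2 * ρ - 2)) * (ENNReal.ofReal ((r₀ ^ 2)⁻¹) *
          ∫⁻ w in Ioo (z₀.1 - r' ^ (2 + ρ)) z₀.1 ×ˢ ball z₀.2 r', ‖v w.1 w.2‖ₑ ^ (3 : ℕ)) := by
        rw [← mul_assoc, ← mul_assoc, ← ENNReal.ofReal_mul (by positivity),
          ← ENNReal.ofReal_mul (by positivity), hsr]
        congr 2
        ring
    _ = ENNReal.ofReal (s ^ (2 * ρ - 2)) *
          ∫⁻ w in Ioo (-(r' ^ (2 + ρ)) / r₀ ^ 2) 0 ×ˢ ball (0 : EuclideanSpace ℝ (Fin 3)) (r' / r₀),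
            ‖(r₀ • stPull (r₀ ^ 2) r₀ z₀.1 z₀.2 v) w.1 w.2‖ₑ ^ (3 : ℕ) := by
        rw [hcov]
    _ ≤ _ := by
        gcongr

/-! ### The package: all hypotheses of Thm 3.1 at `(3, 3, 2, 0)`, `f = r^ρ`, for the zoomed triple -/

/-- One step of the recursive extraction of a strictly decreasing null sequence. [folklore] -/
private theorem exists_seq_strictAnti_of_frequently' {P : ℝ → Prop}
    (h : ∀ δ : ℝ, 0 < δ → ∃ r ∈ Ioo (0 : ℝ) δ, P r) :
    ∃ r : ℕ → ℝ, (∀ k, r k ∈ Ioo (0 : ℝ) 1) ∧ StrictAnti r ∧ Tendsto r atTop (𝓝 0) ∧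
      ∀ k, P (r k) := by
  classical
  let step : ℕ → ℝ → ℝ := fun k x =>
    if hx : 0 < x then (h (min x (1 / ((k : ℝ) + 2))) (lt_min hx (by positivity))).choose else 0
  have hstep : ∀ (k : ℕ) (x : ℝ), 0 < x →
      step k x ∈ Ioo (0 : ℝ) (min x (1 / ((k : ℝ) + 2))) ∧ P (step k x) := by
    intro k x hx
    have hs : step k x = (h (min x (1 / ((k : ℝ) + 2))) (lt_min hx (by positivity))).choose := by
      simp only [step, dif_pos hx]
    rw [hs]
    exact (h (min x (1 / ((k : ℝ) + 2))) (lt_min hx (by positivity))).choose_spec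
  obtain ⟨r₀, hr₀, hP₀⟩ := h 1 one_pos
  let r : ℕ → ℝ := fun n => Nat.rec r₀ (fun k x => step k x) n
  have hr_zero : r 0 = r₀ := rfl
  have hr_succ : ∀ k, r (k + 1) = step k (r k) := fun k => rfl
  have hpos : ∀ k, 0 < r k := by
    intro k
    induction k with
    | zero => rw [hr_zero]; exact hr₀.1
    | succ k ih => rw [hr_succ]; exact (hstep k (r k) ih).1.1
  have hsucc : ∀ k, r (k + 1) < r k ∧ r (k + 1) < 1 / ((k : ℝ) + 2) ∧ P (r (k + 1)) := by
    intro k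
    obtain ⟨hmem, hP⟩ := hstep k (r k) (hpos k)
    rw [hr_succ]
    exact ⟨hmem.2.trans_le (min_le_left _ _), hmem.2.trans_le (min_le_right _ _), hP⟩
  have hanti : StrictAnti r := strictAnti_nat_of_succ_lt fun k => (hsucc k).1
  have hle : ∀ k, r k ≤ 1 / ((k : ℝ) + 1) := by
    intro k
    cases k with
    | zero => rw [hr_zero]; norm_num; exact hr₀.2.le
    | succ k =>
      have := (hsucc k).2.1
      push_cast
      rw [show (k : ℝ) + 1 + 1 = (k : ℝ) + 2 by ring]
      exact this.le
  refine ⟨r, fun k => ⟨hpos k, ?_⟩, hanti, ?_, fun k => ?_⟩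
  · exact (hanti.antitone (Nat.zero_le k)).trans_lt (by rw [hr_zero]; exact hr₀.2)
  · exact squeeze_zero (fun k => (hpos k).le) hle tendsto_one_div_add_atTop_nhds_zero_nat
  · cases k with
    | zero => rw [hr_zero]; exact hP₀
    | succ k => exact (hsucc k).2.2

/-- The origin window of radius `s < 1` lies in `Q(0, 1)`. [folklore] -/
private theorem window_subset_parabolicCylinder_one {ρ s : ℝ} (hρ : 0 < ρ) (hs : s ∈ Ioo (0 : ℝ) 1) :
    Ioo ((0 : ℝ × EuclideanSpace ℝ (Fin 3)).1 - s ^ (2 + ρ)) (0 : ℝ × EuclideanSpace ℝ (Fin 3)).1 ×ˢ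
        ball (0 : ℝ × EuclideanSpace ℝ (Fin 3)).2 s ⊆
      (parabolicCylinderOpens 1 (0 : ℝ × EuclideanSpace ℝ (Fin 3)) :
        Set (ℝ × EuclideanSpace ℝ (Fin 3))) := by
  have h1 : s ^ (2 + ρ) < 1 := Real.rpow_lt_one hs.1.le hs.2 (by positivity)
  change _ ⊆ parabolicCylinder 1 (0 : ℝ × EuclideanSpace ℝ (Fin 3))
  unfold parabolicCylinder
  exact prod_mono (Ioo_subset_Ioo (by simp; linarith) le_rfl) (ball_subset_ball hs.2.le)

/-- **The zoom package.** From the route's scenario data in `Q(z₀, r₀)` — `(v, q)` suitable weak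
with weak gradient `G`, the power-gauged bound (1.7) on `]0, r₀]` and the floor (3.1) in the
"small radii" form — the zoomed triple `(V, P, H) = (r₀ v ∘ Φ, r₀² q ∘ Φ, r₀² G ∘ Φ)` satisfies
every hypothesis of Seregin's Thm 3.1 (`seregin2026_typeII_scenario_eulerLimit`) at
`(s, l, κ) = (3, 3, 2)`, `f(r) = r^ρ`: suitable weak in `Q(0,1)`, weak gradient on `Q(0,1)`, (1.7)
with some `M₁`, and the floor `ε₁ ≤ f(r_k)^{l-1} M̄^{3,3}_2(V, r_k)` along a strictly decreasing
null sequence `r_k ∈ ]0,1[`. [cite: Seregin2026, §1 p. 2 ("by scaling"), (1.7) p. 4, (3.1) p. 8] -/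
theorem exists_unitCylinder_scenario {ρ r₀ : ℝ} (hρ : 0 < ρ) (hr₀ : 0 < r₀)
    (z₀ : ℝ × EuclideanSpace ℝ (Fin 3))
    {v : ℝ → EuclideanSpace ℝ (Fin 3) → EuclideanSpace ℝ (Fin 3)}
    {q : ℝ → EuclideanSpace ℝ (Fin 3) → ℝ}
    {G : ℝ → EuclideanSpace ℝ (Fin 3) → EuclideanSpace ℝ (Fin 3) →L[ℝ] EuclideanSpace ℝ (Fin 3)}
    (hball : IsSuitableWeakSolutionInBall r₀ z₀ v q)
    (hG : HasWeakSpatialGradientOn (parabolicCylinderOpens r₀ z₀) v G)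
    (hM : ∃ M : ℝ≥0, ∀ r ∈ Ioc (0 : ℝ) r₀,
      ENNReal.ofReal (r ^ (2 * ρ)) * cknA r z₀ v + ENNReal.ofReal (r ^ ρ) * cknE r z₀ G +
          ENNReal.ofReal (r ^ (2 * ρ)) * cknD r z₀ q ≤ (M : ℝ≥0∞))
    (hfloor : ∃ ε₀ : ℝ, 0 < ε₀ ∧ ∀ δ : ℝ, 0 < δ → ∃ r ∈ Ioo (0 : ℝ) δ,
      ENNReal.ofReal ε₀ ≤ ENNReal.ofReal (r ^ (2 * ρ - 2)) *
        ∫⁻ w in Ioo (z₀.1 - r ^ (2 + ρ)) z₀.1 ×ˢ ball z₀.2 r, ‖v w.1 w.2‖ₑ ^ (3 : ℕ)) :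
    ∃ (M₁ : ℝ≥0) (ε₁ : ℝ) (r : ℕ → ℝ),
      IsSuitableWeakSolutionInBall 1 0 (r₀ • stPull (r₀ ^ 2) r₀ z₀.1 z₀.2 v)
          (r₀ ^ 2 • stPull (r₀ ^ 2) r₀ z₀.1 z₀.2 q) ∧
        HasWeakSpatialGradientOn (parabolicCylinderOpens 1 (0 : ℝ × EuclideanSpace ℝ (Fin 3)))
          (r₀ • stPull (r₀ ^ 2) r₀ z₀.1 z₀.2 v) (r₀ ^ 2 • stPull (r₀ ^ 2) r₀ z₀.1 z₀.2 G) ∧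
        HasWeightedEnergyBound (fun s => s ^ ρ) M₁ (r₀ • stPull (r₀ ^ 2) r₀ z₀.1 z₀.2 v)
          (r₀ ^ 2 • stPull (r₀ ^ 2) r₀ z₀.1 z₀.2 q) (r₀ ^ 2 • stPull (r₀ ^ 2) r₀ z₀.1 z₀.2 G) ∧
        0 < ε₁ ∧ (∀ k, r k ∈ Ioo (0 : ℝ) 1) ∧ StrictAnti r ∧ Tendsto r atTop (𝓝 0) ∧
        ∀ k, ENNReal.ofReal ε₁ ≤
          ENNReal.ofReal ((fun s : ℝ => s ^ ρ) (r k) ^ ((3 : ℝ) - 1)) *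
            morreyMbar (fun s => s ^ ρ) (kappa 3 3) 3 3 (0 : ℝ × EuclideanSpace ℝ (Fin 3))
              (r₀ • stPull (r₀ ^ 2) r₀ z₀.1 z₀.2 v) (r k) := by
  obtain ⟨M, hM⟩ := hM
  obtain ⟨ε₀, hε₀, hfl⟩ := hfloor
  have hgrad := hasWeakSpatialGradientOn_zoom hr₀ z₀ hG
  obtain ⟨ε₁, hε₁, hfl₁⟩ := floor_zoom hρ hr₀ hε₀ z₀ v hfl
  obtain ⟨r, hr, hanti, hlim, hP⟩ := exists_seq_strictAnti_of_frequently' hfl₁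
  -- measurability of the zoomed field on the windows (inside `Q(0,1)`)
  have hmeas : ∀ k, AEStronglyMeasurable (uncurry (r₀ • stPull (r₀ ^ 2) r₀ z₀.1 z₀.2 v))
      (volume.restrict (Ioo ((0 : ℝ × EuclideanSpace ℝ (Fin 3)).1 - r k ^ (2 + ρ))
        (0 : ℝ × EuclideanSpace ℝ (Fin 3)).1 ×ˢ ball (0 : ℝ × EuclideanSpace ℝ (Fin 3)).2 (r k))) :=
    fun k => (hgrad.locallyIntegrableOn.aestronglyMeasurable).mono_measure
      (Measure.restrict_mono (window_subset_parabolicCylinder_one hρ (hr k)) le_rfl)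
  refine ⟨_, ε₁, r, hball.zoom hr₀, hgrad, hasWeightedEnergyBound_zoom hr₀ z₀ hM, hε₁, hr, hanti,
    hlim, fun k => ?_⟩
  rw [rpow_mul_morreyMbar_rpow_eq (hr k).1 0 _ (hmeas k)]
  exact hP k

/-- **Seregin's Thm 3.1 for the route's scenario in `Q(z₀, r₀)`** (composition with the fact): under
`seregin2026_typeII_scenario_eulerLimit`, a suitable weak solution in `Q(z₀, r₀)` obeying the
power-gauged bound (1.7) with `f = r^ρ`, `0 < ρ ≤ 17/20` (so that (3.3) holds, `growthCondition_rpow`)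
and the floor (3.1) has a non-trivial local-energy Euler limit `(u, p, Gu, c)` on `]-∞, 0[ × ℝ³`
with the bound (3.5) for `F(a) = a^ρ`, the local energy inequality (3.7) and `M^{3,3}_2(u,1) ≥ ε₁/2`
for some `ε₁ > 0` — the conclusion of Thm 3.1 verbatim, at `(s, l, κ, η) = (3, 3, 2, 0)`.
[cite: Seregin2026, Thm 3.1 (p. 9) with §1 p. 2 ("by scaling")] -/
theorem seregin2026_typeII_scenario_eulerLimit.of_powerGauge_ball
    (h : seregin2026_typeII_scenario_eulerLimit) {ρ r₀ : ℝ} (hρ : 0 < ρ) (hρ' : ρ ≤ 17 / 20)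
    (hr₀ : 0 < r₀) (z₀ : ℝ × EuclideanSpace ℝ (Fin 3))
    {v : ℝ → EuclideanSpace ℝ (Fin 3) → EuclideanSpace ℝ (Fin 3)}
    {q : ℝ → EuclideanSpace ℝ (Fin 3) → ℝ}
    {G : ℝ → EuclideanSpace ℝ (Fin 3) → EuclideanSpace ℝ (Fin 3) →L[ℝ] EuclideanSpace ℝ (Fin 3)}
    (hball : IsSuitableWeakSolutionInBall r₀ z₀ v q)
    (hG : HasWeakSpatialGradientOn (parabolicCylinderOpens r₀ z₀) v G)
    (hM : ∃ M : ℝ≥0, ∀ r ∈ Ioc (0 : ℝ) r₀,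
      ENNReal.ofReal (r ^ (2 * ρ)) * cknA r z₀ v + ENNReal.ofReal (r ^ ρ) * cknE r z₀ G +
          ENNReal.ofReal (r ^ (2 * ρ)) * cknD r z₀ q ≤ (M : ℝ≥0∞))
    (hfloor : ∃ ε₀ : ℝ, 0 < ε₀ ∧ ∀ δ : ℝ, 0 < δ → ∃ r ∈ Ioo (0 : ℝ) δ,
      ENNReal.ofReal ε₀ ≤ ENNReal.ofReal (r ^ (2 * ρ - 2)) *
        ∫⁻ w in Ioo (z₀.1 - r ^ (2 + ρ)) z₀.1 ×ˢ ball z₀.2 r, ‖v w.1 w.2‖ₑ ^ (3 : ℕ)) :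
    ∃ (ε₁ : ℝ) (u : ℝ → EuclideanSpace ℝ (Fin 3) → EuclideanSpace ℝ (Fin 3))
      (p : ℝ → EuclideanSpace ℝ (Fin 3) → ℝ)
      (Gu : ℝ → EuclideanSpace ℝ (Fin 3) → EuclideanSpace ℝ (Fin 3) →L[ℝ] EuclideanSpace ℝ (Fin 3))
      (c : ℝ≥0), 0 < ε₁ ∧
      IsDistributionalEulerSolutionOn (slab (EuclideanSpace ℝ (Fin 3)) (Iio 0) isOpen_Iio) 0 u p ∧
      HasWeakSpatialGradientOn (slab (EuclideanSpace ℝ (Fin 3)) (Iio 0) isOpen_Iio) u Gu ∧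
      (∀ a : ℝ, 0 < a →
        weightedA (fun a => a ^ ρ) a (0 : ℝ × EuclideanSpace ℝ (Fin 3)) u +
            weightedD (fun a => a ^ ρ) a (0 : ℝ × EuclideanSpace ℝ (Fin 3)) p +
            weightedE (fun a => a ^ ρ) a (0 : ℝ × EuclideanSpace ℝ (Fin 3)) Gu ≤ c) ∧
      (∀ φ : ℝ → EuclideanSpace ℝ (Fin 3) → ℝ,
        IsSpaceTimeTestOn (⊤ : TopologicalSpace.Opens (ℝ × EuclideanSpace ℝ (Fin 3))) φ →
          (∀ t x, 0 ≤ φ t x) →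
          ∀ᵐ τ₀ ∂(volume : Measure ℝ), τ₀ < 0 →
            ∫ y, ‖u τ₀ y‖ ^ 2 * φ τ₀ y ≤
              ∫ z in {z : ℝ × EuclideanSpace ℝ (Fin 3) | z.1 < τ₀}, localEnergyRHS 0 0 u p φ z) ∧
      ENNReal.ofReal (ε₁ / 2) ≤ morreyM (kappa 3 3) 3 3 (0 : ℝ × EuclideanSpace ℝ (Fin 3)) u 1 := by
  obtain ⟨M₁, ε₁, r, hball₁, hgrad₁, hweb, hε₁, hr, hanti, hlim, hfl⟩ :=
    exists_unitCylinder_scenario hρ hr₀ z₀ hball hG hM hfloor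
  obtain ⟨h1, hκ0, hκ3, hη, hp, hq⟩ := params_three_three_zero
  obtain ⟨u, p, Gu, c, hE, hGu, hbd, hlei, hM1⟩ :=
    h _ _ _ (fun s => s ^ ρ) (fun a => a ^ ρ) 3 3 0 ε₁ r hball₁ hgrad₁ (isScenarioWeight_rpow hρ)
      ⟨M₁, hweb⟩ h1 h1 hκ0 hκ3 hη hp hq hε₁ hr hanti hlim hfl (growthCondition_rpow hρ hρ')
  exact ⟨ε₁, u, p, Gu, c, hε₁, hE, hGu, hbd, hlei, hM1⟩

end Literature.Analysis.FluidPDE.Seregin2023
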